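import Summits.RiemannHypothesis.RiemannHypothesis.Theorems.TiltedLandingLaw421R3TouchedGlueHCount

/-! # HORIZON-STATEMENT-v1 — tree typing of FIT2-SYMBOLIC-v2 §6 (A1) (lens-2 g9 O10-d; STATEMENT file, registry-neutral; ONE TREE import #1217; memo `lens2/HORIZON-MEMO-v1.md`)
(A1) «N_β + netCost(Γ4) ≤ K_tree ≤ (1−ε)²ρ₀²P/(8c_v)».  (i) LEFT = BOOKKEEPING, (K)-shaped (net cost ≤ number of charged class levels + rise penalties, the pattern of
`netCostQ_beta_le_card_add_penalty`; charged levels precede the window's first NL event since `ReadyR2 = CumReady WinOrTilt ⊇ TiltReady`), so K_tree is typed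
STATE-FREE as «every charged index» ((CA747)(D)).  (ii) RIGHT = DYNAMICS: literally `HorizonCapQ θ aH`, θ = (1−ε)²/(2c_v) ≤ 1 (`energyPurseQ = ρ₀²P/4`); E12-T2's
K_tree/(ρ₀²P) ≤ .250 on 5 147 rows is `HorizonCapQ 1 (budgetConst 1)` row-wise.  VERDICT: it follows from NO tree declaration, and it is NOT an admissible fourth
Γ-side hypothesis: via `energyPurseQ_le` it caps `chargeCount` by a purse below `halfPurse` — the RATE HALF's conclusion (`RestRateBotPQ`) sharpened, up to the
books' (K) algebra (crux-strength; COSTUME if fed to ★A).  FIT‴'s closed-form margins thus certify CONSISTENCY of (Γ4, FIT‴) on designs, not a weaker law.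
LAW-shaped statements behind (ii): `LowDissipationLawQ c aH` (lowest pair, cumulative; F1 is its per-FAR-level shadow; ⟹ `HorizonCapQ c⁻¹ (c⁻¹aH)`, proved;
lifts ROOF6/8 violate it pointwise unless `aH` absorbs them) and the lens-2 candidate `WindowDissipationLawQ c aH` on the TOTAL window energy (lifts = internal
redistribution; tilted isolated pair EXACT `h′² = h² − g⁻²`; toy numerics + the doubly-stochastic identity in the memo).  Either would REPLACE, not add to, the open
content of Γ4 / F1 — a director + critics decision.  Nothing here bears on the truth of RH; RH is not proved; every Prop below is a typed OPEN candidate. -/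

namespace RhW08.Horizon

open RhW08.Round1 RhW08.StSwap RhW08.Round2 RhW08.QuadW RhW08.SealSwapQ RhW08.PurseP RhW08.TouchedGlueW RhIdea6.G17.W07C7 RhIdea6.G17.W07C7.Rev6
open RhW08.SealSwap (PBot)
open RhIdea6.G18.W07C8.Law421BirthS RhIdea6.G19.W07C11.Seam RhIdea6.G20.W07C12.Frac RhIdea6.G20.W07C12.StColP RhW07.C12.FieldSplit RhW07.C14.TwoSided RhW07.C14.Classes

/-- (A1)(ii) LITERAL — **HORIZON CAP** (crux-strength, see header): every charged level index `k` of a legal frame satisfies `k + 1 ≤ θ·energyPurseQ F + aH F`. -/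
def HorizonCapQ (θ : ℝ) (aH : Budget) : Prop :=
  ∀ (η : ℝ) (f : ℂ → ℂ) (x₀ s hmax R Hs : ℝ) (B : ℕ), EngineHyps5 2 η f x₀ s hmax R Hs B →
    ∀ k : ℕ, Charged (PTrkSQ PBot) StTrkDQ ReadyR2 η f x₀ s hmax R Hs B k → (k : ℝ) + 1 ≤ θ * energyPurseQ η f x₀ s hmax R Hs B + aH η f x₀ s hmax R Hs B

/-- CANDIDATE LAW **LOW DISSIPATION** (lowest pair, cumulative): `c·s²/η²` of Jensen energy dissipated PER LEVEL on average up to every charged level, allowance `aH`. -/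
def LowDissipationLawQ (c : ℝ) (aH : Budget) : Prop :=
  ∀ (η : ℝ) (f : ℂ → ℂ) (x₀ s hmax R Hs : ℝ) (B : ℕ), EngineHyps5 2 η f x₀ s hmax R Hs B →
    ∀ k : ℕ, Charged (PTrkSQ PBot) StTrkDQ ReadyR2 η f x₀ s hmax R Hs B k →
      c * ((k : ℝ) + 1) * s ^ 2 ≤ η ^ 2 * (lowH StTrkDQ η f x₀ s hmax R Hs B 0 ^ 2 - lowH StTrkDQ η f x₀ s hmax R Hs B (k + 1) ^ 2)
        + s ^ 2 * aH η f x₀ s hmax R Hs B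

/-- (K) the low dissipation law gives the horizon cap at `θ = c⁻¹`, allowance `c⁻¹·aH`. -/
theorem horizonCap_of_lowDissipation {c : ℝ} {aH : Budget} (hc : 0 < c) (h : LowDissipationLawQ c aH) :
    HorizonCapQ c⁻¹ (fun η f x₀ s hmax R Hs B => c⁻¹ * aH η f x₀ s hmax R Hs B) := by
  intro η f x₀ s hmax R Hs B hE k hk
  have hs2 : 0 < s ^ 2 := pow_pos hE.2.2.2.1 2; have h1 := h η f x₀ s hmax R Hs B hE k hk
  have h0 : 0 ≤ η ^ 2 * lowH StTrkDQ η f x₀ s hmax R Hs B (k + 1) ^ 2 := mul_nonneg (sq_nonneg _) (sq_nonneg _)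
  have h2 : c * ((k : ℝ) + 1) ≤ energyPurseQ η f x₀ s hmax R Hs B + aH η f x₀ s hmax R Hs B := by
    have : c * ((k : ℝ) + 1) ≤ (η ^ 2 * lowH StTrkDQ η f x₀ s hmax R Hs B 0 ^ 2 + s ^ 2 * aH η f x₀ s hmax R Hs B) / s ^ 2 := by
      rw [le_div_iff₀ hs2]; nlinarith
    simpa [energyPurseQ, add_div, mul_div_assoc, mul_div_cancel_left₀ _ (ne_of_gt hs2)] using this
  rw [← mul_add, inv_mul_eq_div, le_div_iff₀ hc]; linarith

/-- the TOTAL WINDOW ENERGY at level `j`: the Jensen energies `η²·(Im u)²/s²` of the band-window states of `f⁽ʲ⁾`, with multiplicity (a finite sum on a legal frame). -/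
noncomputable def windowEnergyQ (η : ℝ) (f : ℂ → ℂ) (x₀ s hmax R Hs : ℝ) (B j : ℕ) : ℝ :=
  ∑ᶠ u ∈ {u : ℂ | StTrkDQ η f x₀ s hmax R Hs B j u}, ((analyticOrderAt (iteratedDeriv j f) u).toNat : ℝ) * (η ^ 2 * u.im ^ 2 / s ^ 2)

/-- the WINDOW MASS at level `j`: the number of band-window states of `f⁽ʲ⁾`, with multiplicity. -/
noncomputable def windowMassQ (η : ℝ) (f : ℂ → ℂ) (x₀ s hmax R Hs : ℝ) (B j : ℕ) : ℝ :=
  ∑ᶠ u ∈ {u : ℂ | StTrkDQ η f x₀ s hmax R Hs B j u}, ((analyticOrderAt (iteratedDeriv j f) u).toNat : ℝ)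

/-- CANDIDATE LAW **WINDOW DISSIPATION** (lens-2): up to every charged level the total window energy drops by `≥ c` per unit window mass per level, allowance `aH`. -/
def WindowDissipationLawQ (c : ℝ) (aH : Budget) : Prop :=
  ∀ (η : ℝ) (f : ℂ → ℂ) (x₀ s hmax R Hs : ℝ) (B : ℕ), EngineHyps5 2 η f x₀ s hmax R Hs B →
    ∀ k : ℕ, Charged (PTrkSQ PBot) StTrkDQ ReadyR2 η f x₀ s hmax R Hs B k →
      c * ∑ j ∈ Finset.range (k + 1), windowMassQ η f x₀ s hmax R Hs B j
        ≤ windowEnergyQ η f x₀ s hmax R Hs B 0 - windowEnergyQ η f x₀ s hmax R Hs B (k + 1) + aH η f x₀ s hmax R Hs B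

end RhW08.Horizon
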